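import Literature.NumberTheory.EllipticCurves.KramerTunnell1982.UnramifiedNormIndex
import Literature.NumberTheory.QuadraticForms.HilbertSymbol
import Mathlib.AlgebraicGeometry.EllipticCurve.Reduction
import Mathlib.Analysis.Complex.Basic
import HarnessLib

/-!
# Kramer 1981, §2: the cokernel `E(F)/N E(K)` of the local norm for a quadratic extension `K/F` of a
# `p`-adic field — Propositions 1, 2(a) (multiplicative reduction), 3 (ramified, odd residue
# characteristic, good reduction) and 6 (archimedean), AS PRINTED

Source: K. Kramer, *Arithmetic of elliptic curves upon quadratic extension*, Trans. Amer. Math. Soc.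
264 (1981) 121–135, doi:10.1090/s0002-9947-1981-0597871-8 [Kramer1981], §2 "The cokernel of the local
norm" (PUBLISHED, refereed; held text `paper:doi-10-1090-s0002-9947-1981-0597871-8`, locators
`pNNNN Lk` of its materialised pages = printed pp. 123–127). THREE named facts (`def … : Prop`,
D-0014, nothing asserted), in the vocabulary of `KramerTunnell1982/UnramifiedNormIndex.lean`
(`normSubgroup E K' σ = N E(K)`, `fixedSubgroup E K' σ = E(K)^σ = E(F)`, the index
`#(E(F)/N E(K)) = 2^{i(K/F)}` as `AddSubgroup.relIndex`), Mathlib's minimal models and reduction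
(`WeierstrassCurve.minimal`, `HasGoodReduction`, `HasMultiplicativeReduction`,
`HasSplitMultiplicativeReduction`, `reduction`), the tree's Hilbert symbol
(`QuadraticForms.hilbertSymbol F a b = (a, b)_F`), `maxUnramified F` and `kodairaSymbol`. Requested by
the cell `bsd-uniform`, track U2 (`pub/bsd-uniform/u2/INGREDIENTS.md` §4/§6: the local indices
`δ_v = i_v` of a quadratic twist at the RAMIFIED odd prime — where "`a_q` odd" acts through
`E(𝔽_q)[2] = 0` — at the multiplicative places and at `∞`; the UNRAMIFIED places, residue
characteristic `2` included, are Kramer–Tunnell 1982 Lemma 6.1, already vendored).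

## The printed statements, verbatim

Setting [p0004 L6–L13]: "Throughout this section, `F` is a finite extension of `ℚ_p` and its
valuation `v` is written additively. `E` is an elliptic curve defined over `F`, with an integral model
whose discriminant `Δ` has minimal valuation. We consider those `d ∈ F` for which `K = F(d^{1/2})` is
a quadratic extension of `F`. The cokernel of the local norm mapping `N : E(K) → E(F)` is a finite
vector space over `F_2` whose dimension we denote by `i(K/F)`. We shall often express `i(K/F)` in
terms of the Hilbert norm-residue symbol, a bimultiplicative form `( , )_F : F* × F* → μ_2`".
[p0004 L14–L15]: "If `K` over `F` is unramified and `E` has good reduction then `i(K/F) = 0` according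
to [8, Corollary 4.2]" (Mazur; = Kramer–Tunnell Lemma 6.1, type `I_0`). [p0004 L16–L24]: "If `E` is a
Tate curve [7, p. 197] over `F`, then there is an element `q` in `F` with `Δ = q ∏ (1 − q^n)^{24}` such
that `E` is isomorphic to `G_m/q^ℤ` … If `E` is twisted by the quadratic extension `L`, then `E`
becomes isomorphic to `G_m/q^ℤ` over any field containing `L`."
* **Proposition 1** [p0004 L42–L43]: "Suppose that `E` is a Tate curve. Then `i(K/F)` is `0` or `1`,
  according to whether `(Δ, d)_F` is `−1` or `+1`."
* **Proposition 2** [p0004 L52–L56]: "Suppose that `E` is a twisted Tate curve, twisted by the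
  unramified quadratic extension `L`. (a) If `K` is unramified over `F`, then `i(K/F)` is `0` or `1`
  according to whether `v(Δ)` is odd or even. (b) If `K` is ramified over `F`, then `i(K/F) = …`"
  — the display of (b) is illegible in the held scan and is NOT vendored.
* **Proposition 3** [p0006 L45–L47]: "Suppose that `K` over `F` is a ramified extension with residue
  field `k` having odd characteristic. If `E` has good reduction modulo `π_F` then
  `i(K/F) = dim E(k)_2`. Moreover `i(K/F)` is even or odd according to whether `(Δ, d)_F = ±1`."
  (proof, p0006 L49–L57: "`i(K/F) = dim E(k)/2E(k) = dim E(k)_2`. It is clear … that `dim E(k)_2` is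
  even if and only if, upon reduction, `Δ` becomes a square in `k`".)
* **Proposition 6** [p0008 L51–L52]: "For Archimedean primes `i(ℂ/ℝ)` is `0` or `1` according to
  whether `Δ` is negative or positive." (proof: "`N{E(ℂ)} = 2E(ℝ)`. Hence
  `i(ℂ/ℝ) = dim E(ℝ)/2E(ℝ)`".)
Not vendored: Prop. 2 (b) (illegible display), Props. 4–5 (`F/ℚ_2` unramified, `K/F` ramified,
supersingular / ordinary reduction at `2`) — `-- TODO(general form)` below; Theorems 1–2 and
Prop. 7 (global) are the parity material of `TwoSelmerRankQuadraticParity.lean` /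
`BSDSelmerParity…` (Kramer Thm. 1 with Prop. 3, cited there).

## Transcription (tree vocabulary; nothing re-declared)

* "`F` a finite extension of `ℚ_p`": a Mathlib nonarchimedean local field of characteristic `0`
  (`IsNonarchimedeanLocalField F`, `CharZero F`; valuation ring `𝒪[F]`, residue field
  `IsLocalRing.ResidueField 𝒪[F] = k`); "residue field of odd characteristic":
  `ringChar (IsLocalRing.ResidueField 𝒪[F]) ≠ 2`.
* "`E` … with an integral model whose discriminant `Δ` has minimal valuation": any Weierstrass model
  `E/F` (`[E.IsElliptic]`) and `Δ := (E.minimal 𝒪[F]).Δ`, the discriminant of Mathlib's minimal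
  model (every printed use of `Δ` — `(Δ, d)_F`, the parity of `v(Δ)`, "`Δ` a square in `k`" — is
  invariant under `Δ ↦ u^{12} Δ`, `u ∈ 𝒪^×`, so the choice of minimal model is immaterial).
* "`K = F(d^{1/2})` a quadratic extension": an intermediate field `K'` of `F̄/F` with `[K' : F] = 2`,
  an element `d : F` that is not a square in `F` and `x ∈ K'` with `x² = d` (then `K' = F(√d)`),
  and `σ ≠ 1` in `Aut(K'/F)` (the generator `g` of `Gal(K/F)`, as in Kramer–Tunnell); "`K/F`
  unramified" = `K' ≤ maxUnramified F`, "ramified" = its negation (a quadratic extension of a local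
  field is unramified iff it lies in the maximal unramified extension).
* "`i(K/F) = i`" (the `F_2`-dimension of `E(F)/N E(K)`) = "`#(E(K')^σ / N E(K')) = 2^i`" =
  `(normSubgroup E K' σ).relIndex (fixedSubgroup E K' σ) = 2 ^ i` (`E(K')^σ = E(F)` by Galois
  descent); so "`i(K/F)` is `0` or `1` according to …" = "the index is `1` resp. `2`".
* "`E` is a Tate curve" = split multiplicative reduction (the printed gloss "isomorphic to `G_m/q^ℤ`
  over `F`"; Mathlib `HasSplitMultiplicativeReduction 𝒪[F]` of the minimal model); "a twisted Tate
  curve, twisted by the unramified quadratic extension `L`" = multiplicative, not split (non-split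
  multiplicative reduction becomes split exactly over the unramified quadratic extension);
  "`v(Δ)` odd / even" for such a curve = Kodaira type `I_v` of the minimal model with `v = v_F(Δ)`
  odd / even (Tate's algorithm: multiplicative reduction of type `I_v` has `v = v(Δ_min)`; the same
  dictionary as Kramer–Tunnell's printed "`I_v` with `v_F(Δ) = v`"), via the tree's
  `E.kodairaSymbol 𝒪[F]`.
* "`E` has good reduction modulo `π_F`" = `HasGoodReduction 𝒪[F]` of the minimal model; "`E(k)`" =
  the points of its reduction `((E.minimal 𝒪[F]).reduction 𝒪[F])` over `k`; "`dim E(k)_2 = i`" =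
  `#E(k)[2] = 2^i`, so "`i(K/F) = dim E(k)_2`" = "index `= #E(k)[2]`" (`AddSubgroup.torsionBy`).
* "`(Δ, d)_F = ±1`" = `QuadraticForms.hilbertSymbol F Δ d = ±1` (O'Meara's definition, `ℤ`-valued).
* Prop. 6: `F = ℝ`, `K = ℂ`, `σ` = complex conjugation (`Complex.conjAe`), `Δ` of any model over `ℝ`
  (its sign is model-independent).

Faithfulness: binders verbatim; weaker than print only in fixing `F` to Mathlib's local fields.
Nothing here is in Mathlib or the tree (2026-08-22: `lean search 'normIndex|Kramer1981'` — the tree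
cites Kramer 1981 only for the GLOBAL parity formula Thm. 1, `TwoSelmerRankQuadraticParity.lean`;
the local cokernel has no prior vocabulary besides `KramerTunnell1982/`).
-- TODO(general form): Prop. 2 (b); Props. 4–5 (residue characteristic 2, `K/F` ramified:
-- `i(K/F)` for supersingular resp. ordinary reduction in terms of `v(d)`, `[F : ℚ_2]`, `(Δ, d)_F`).
-/

noncomputable section

open ValuativeRel Field
open Literature.NumberTheory.GaloisRepresentations.IsNonarchimedeanLocalField
open Literature.NumberTheory.DiophantineGeometry
open Literature.NumberTheory.EllipticCurves.KramerTunnell1982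
open Literature.NumberTheory.QuadraticForms

namespace Literature.NumberTheory.EllipticCurves.Kramer1981

section Fact

open scoped Classical

/-- **Kramer 1981, Propositions 1 and 2 (a)** (Trans. AMS 264, §2, p. 123; verbatim in the module
docstring), the MULTIPLICATIVE places. Setting as printed: `F` a finite extension of `ℚ_p`, `E/F` an
elliptic curve with minimal discriminant `Δ`, `K = F(√d)` a quadratic extension, `2^{i(K/F)} =
#(E(F)/N E(K))`. (1) [Prop. 1] "Suppose that `E` is a Tate curve [split multiplicative reduction]. Then
`i(K/F)` is `0` or `1`, according to whether `(Δ, d)_F` is `−1` or `+1`" — typed: the index is `1` if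
`(Δ, d)_F = −1` and `2` if `(Δ, d)_F = 1`. (2) [Prop. 2 (a)] "Suppose that `E` is a twisted Tate curve,
twisted by the unramified quadratic extension `L` [non-split multiplicative reduction]. If `K` is
unramified over `F`, then `i(K/F)` is `0` or `1` according to whether `v(Δ)` is odd or even" — typed
with `v(Δ) = v` read off the Kodaira type `I_v` of the minimal model: index `1` for `v` odd, `2` for
`v` even. Named fact (PUBLISHED); nothing asserted; users take `(h : props1_2a_multiplicativeNormIndex)`.
[cite: Kramer1981, §2 Prop. 1 and Prop. 2 (a) (p. 123)] -/
def props1_2a_multiplicativeNormIndex : Prop :=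
  ∀ (F : Type) [Field F] [ValuativeRel F] [TopologicalSpace F] [IsNonarchimedeanLocalField F]
    [CharZero F] (E : WeierstrassCurve F) [E.IsElliptic]
    (K' : IntermediateField F (AlgebraicClosure F)) (_h2 : Module.finrank F K' = 2)
    (σ : K' ≃ₐ[F] K') (_hσ : σ ≠ 1) (d : F) (_hd : ¬ IsSquare d) (x : K')
    (_hx : x ^ 2 = algebraMap F K' d),
    -- (1) Prop. 1: `E` a Tate curve (split multiplicative reduction)
    ((E.minimal 𝒪[F]).HasSplitMultiplicativeReduction 𝒪[F] →
      (hilbertSymbol F (E.minimal 𝒪[F]).Δ d = -1 →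
          (normSubgroup E K' σ).relIndex (fixedSubgroup E K' σ) = 1) ∧
        (hilbertSymbol F (E.minimal 𝒪[F]).Δ d = 1 →
          (normSubgroup E K' σ).relIndex (fixedSubgroup E K' σ) = 2)) ∧
    -- (2) Prop. 2 (a): `E` a twisted Tate curve (non-split multiplicative), `K/F` unramified
    ((E.minimal 𝒪[F]).HasMultiplicativeReduction 𝒪[F] →
      ¬ (E.minimal 𝒪[F]).HasSplitMultiplicativeReduction 𝒪[F] → K' ≤ maxUnramified F →
      ∀ v : ℕ, E.kodairaSymbol 𝒪[F] = .I v →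
        (Odd v → (normSubgroup E K' σ).relIndex (fixedSubgroup E K' σ) = 1) ∧
          (Even v → (normSubgroup E K' σ).relIndex (fixedSubgroup E K' σ) = 2))

/-- **Kramer 1981, Proposition 3** (Trans. AMS 264, §2, p. 125; verbatim in the module docstring), the
RAMIFIED odd places of good reduction: "Suppose that `K` over `F` is a ramified extension with residue
field `k` having odd characteristic. If `E` has good reduction modulo `π_F` then `i(K/F) = dim E(k)_2`.
Moreover `i(K/F)` is even or odd according to whether `(Δ, d)_F = ±1`." Typed: for `F` (char. `0`,
residue characteristic `≠ 2`), `E/F` with good reduction (minimal model), `K' = F(√d)` quadratic and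
NOT inside the maximal unramified extension, `σ ≠ 1`: `#(E(K')^σ / N E(K')) = #Ē(k)[2]` (both sides
powers of `2`: `2^{i(K/F)} = 2^{dim E(k)_2}`), and, writing the index as `2^i`, `i` is even iff
`(Δ, d)_F = 1`. This is the place where an `a_q`-ODD hypothesis acts in a `2`-descent over `ℚ(√±q)`:
`#Ē(𝔽_q) = q + 1 − a_q` odd ⇒ `Ē(𝔽_q)[2] = 0` ⇒ `i = 0`. Named fact (PUBLISHED); nothing asserted;
users take `(h : prop3_ramifiedOddGoodNormIndex)`.
[cite: Kramer1981, §2 Prop. 3 (p. 125)] -/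
def prop3_ramifiedOddGoodNormIndex : Prop :=
  ∀ (F : Type) [Field F] [ValuativeRel F] [TopologicalSpace F] [IsNonarchimedeanLocalField F]
    [CharZero F] (_hodd : ringChar (IsLocalRing.ResidueField 𝒪[F]) ≠ 2)
    (E : WeierstrassCurve F) [E.IsElliptic] (_hgood : (E.minimal 𝒪[F]).HasGoodReduction 𝒪[F])
    (K' : IntermediateField F (AlgebraicClosure F)) (_h2 : Module.finrank F K' = 2)
    (_hram : ¬ K' ≤ maxUnramified F)
    (σ : K' ≃ₐ[F] K') (_hσ : σ ≠ 1) (d : F) (_hd : ¬ IsSquare d) (x : K')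
    (_hx : x ^ 2 = algebraMap F K' d),
    (normSubgroup E K' σ).relIndex (fixedSubgroup E K' σ) =
        Nat.card (AddSubgroup.torsionBy
          ((E.minimal 𝒪[F]).reduction 𝒪[F]).toAffine.Point (2 : ℤ)) ∧
      ∃ i : ℕ, (normSubgroup E K' σ).relIndex (fixedSubgroup E K' σ) = 2 ^ i ∧
        (Even i ↔ hilbertSymbol F (E.minimal 𝒪[F]).Δ d = 1)

/-- **Kramer 1981, Proposition 6** (Trans. AMS 264, §2, p. 127; verbatim in the module docstring), the
ARCHIMEDEAN place: "For Archimedean primes `i(ℂ/ℝ)` is `0` or `1` according to whether `Δ` is negative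
or positive" (proof: "`N{E(ℂ)} = 2E(ℝ)`. Hence `i(ℂ/ℝ) = dim E(ℝ)/2E(ℝ)`"). Typed: for an elliptic
`E/ℝ` (any model; the sign of `Δ` is model-independent) and `σ` = complex conjugation on `ℂ`,
`#(E(ℂ)^σ / N E(ℂ))` is `1` if `Δ < 0` and `2` if `Δ > 0`. Named fact (PUBLISHED); nothing asserted;
users take `(h : prop6_archimedeanNormIndex)`. [cite: Kramer1981, §2 Prop. 6 (p. 127)] -/
def prop6_archimedeanNormIndex : Prop :=
  ∀ (E : WeierstrassCurve ℝ) [E.IsElliptic],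
    (E.Δ < 0 → (normSubgroup E ℂ Complex.conjAe).relIndex (fixedSubgroup E ℂ Complex.conjAe) = 1) ∧
      (0 < E.Δ → (normSubgroup E ℂ Complex.conjAe).relIndex (fixedSubgroup E ℂ Complex.conjAe) = 2)

/-! ### API (proved): the consumer shape at an `a_q`-odd ramified prime (unfolding) -/

/-- **Consumable form of Prop. 3, first clause**: under the fact, if the reduction has NO point of
order `2` over `k` (`Ē(k)[2] = 0`, e.g. `#Ē(𝔽_q) = q + 1 − a_q` odd), then every `σ`-fixed point of
`E(K')` is a norm — `i(K/F) = 0`, the `δ_v = 0` input of a `2`-Selmer transport at the ramified odd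
prime (Mathlib `AddSubgroup.relIndex_eq_one`). [cite: Kramer1981, §2 Prop. 3 (p. 125), case dim E(k)_2 = 0 (unfolding)] -/
theorem prop3_ramifiedOddGoodNormIndex.fixed_le_norm_of_card_torsion_eq_one
    (h : prop3_ramifiedOddGoodNormIndex)
    (F : Type) [Field F] [ValuativeRel F] [TopologicalSpace F] [IsNonarchimedeanLocalField F]
    [CharZero F] (hodd : ringChar (IsLocalRing.ResidueField 𝒪[F]) ≠ 2)
    (E : WeierstrassCurve F) [E.IsElliptic] (hgood : (E.minimal 𝒪[F]).HasGoodReduction 𝒪[F])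
    (K' : IntermediateField F (AlgebraicClosure F)) (h2 : Module.finrank F K' = 2)
    (hram : ¬ K' ≤ maxUnramified F) (σ : K' ≃ₐ[F] K') (hσ : σ ≠ 1) (d : F) (hd : ¬ IsSquare d)
    (x : K') (hx : x ^ 2 = algebraMap F K' d)
    (htors : Nat.card (AddSubgroup.torsionBy
      ((E.minimal 𝒪[F]).reduction 𝒪[F]).toAffine.Point (2 : ℤ)) = 1) :
    fixedSubgroup E K' σ ≤ normSubgroup E K' σ :=
  AddSubgroup.relIndex_eq_one.mp (((h F hodd E hgood K' h2 hram σ hσ d hd x hx).1).trans htors)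

end Fact

end Literature.NumberTheory.EllipticCurves.Kramer1981

end
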